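import Summits.AtomisticToContinuum.HydrodynamicLimit.Theorems.RelayRaceLocalityNearConstantShortTimeHLGronwallReduction
import Summits.AtomisticToContinuum.HydrodynamicLimit.Theorems.RelayRaceLocalityNearConstantShortTimeHLExpTailDefs
import Summits.AtomisticToContinuum.HydrodynamicLimit.Theorems.RelayRaceLocalityNearConstantShortTimeHLExpCapDefs
import Summits.AtomisticToContinuum.HydrodynamicLimit.Theorems.RelayRaceLocalityNearConstantShortTimeHLIntExpMarkov
import Summits.AtomisticToContinuum.HydrodynamicLimit.Theorems.RelayRaceLocalityNearConstantShortTimeHLTrueLawClosureDefs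
import HarnessLib

/-!
# Crux `NearConstantShortTimeHL` (stmt-AtomisticToContinuum-12502), line `small-tilt-domination`, skeleton v25 "TL" (lead c10):
# `stub_reductionTL` — level 0 of the Grönwall assembly with the closure inputs ALONG THE TRUE LAW (no event import)

Support file (`--supports stmt-AtomisticToContinuum-12502`). Skeleton v25 drops the equilibrium event import `P_N ≤ e^{Cδ₀ n} G_N`
(`TiltDomination`) together with the equilibrium K-stubs, and types the two closure inputs along the true law `P_N` as convergence in
probability: S2ᵀ `TrueLawMomentumClosure` / S3ᵀ `TrueLawEnergyClosure` (`…TrueLawClosureDefs`; same binder as S4‴ `TrueLawCapsPE`,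
`…ExpTailDefs`), consumed by the dynamic theorem `DynamicTheoremTL` (same file) through its hypotheses `hPmom` / `hPen`. This file is
level 0 of the assembly in that currency: the landed `stub_reductionPX` (`…ReductionPX`) with DELETIONS — the box `M'`, the import
constant `eventImport_of_tiltDomination`, the K-stub rates `c₂, c₃, c₀`, the cap level `K`, the clipped reference state `(1, uref, θref)`,
the closeness of the tilt `hclose`, the import `hImp` and the rate weakening `hrate` are gone; `δ₀ := 1` and `τ₀ := 1` (near-constancy of
the data is idle: Yau's method needs none, the crux keeps it); no case split on `1 ≤ M` is needed any more (the temperature guard only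
feeds `solution_box`). What remains, verbatim: the universal thresholds (`ηP := min (min ηK2 ηK3) (ηE/2)`, `η₀ := min (ηP/2) (min (min ηS
η3p) ηL)`), the activity inversion S5a and the identification of the Euler data at `t = 0` (`profiles_eq_of_tendsto`: two LLNs under the same
laws — this is where the tie is consumed), the constant `e^c` dropping out of the canonical law, the LDA at `0` (`stub_ldaGeneralFamilies`),
St3 along the solution, the bookkeeping `xr_bookkeeping`, the box `solution_box`, St2′ along the solution, the packing cap and the family
of exponential velocity moments from `TrueLawCapsPE` at level `ηP`, the integrated-exponential-cap failure bound by `intExpMoment_markov`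
(`C₄ := t max(A₁, 0)`); NEW: the two true-law closure inputs are unpacked at the data exactly like `TrueLawCapsPE` (thresholds `σ2, σ3` of
the profile enter `σ₀ := min (min σ5 σ4) (min σ2 σ3)`; packing band `ρσ³ < η₀ ≤ ηP/2 ≤ ηK/2`) and handed to `DynamicTheoremTL` with the cap
level `K` moved from the last to the first binder.
References: H.-T. Yau, Lett. Math. Phys. 22 (1991) §2; S. Olla – S.R.S. Varadhan – H.-T. Yau, Comm. Math. Phys. 155 (1993) §3; C. Kipnis –
C. Landim, Scaling Limits of Interacting Particle Systems (1999) Ch. 6 §1.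
-/

noncomputable section

namespace Summit.AtomisticToContinuum.HydrodynamicLimit.Theorems.NearConstantShortTimeHL

open scoped BigOperators ENNReal Topology
open MeasureTheory Set Filter
open Literature.MathematicalPhysics.KineticTheory Literature.Analysis.FluidPDE Literature.Analysis.FunctionSpaces

open scoped Real
open Real (exp log)
open ENNReal (ofReal)

/-- **Level 0 with true-law closure inputs (`stub_reductionTL`, registered stub of skeleton v25): thresholds, activity inversion,
identification, and the reduction of `OneMeanLowerBound` to the dynamic theorem `DynamicTheoremTL` at fixed data**, from St2′
`MesoscaleSuperlinearityE`, St3 `UniformPressureAlongSolution`, S5a `GeneralFamilyStaticLLN`, S1 and the inputs S2ᵀ `TrueLawMomentumClosure`,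
S3ᵀ `TrueLawEnergyClosure`, S4‴ `TrueLawCapsPE`. The landed `stub_reductionPX` minus the import / reference box / rates: `δ₀ := 1`, `τ₀ := 1`,
the three true-law inputs unpacked at the identified data (`P_N` = the canonical local Gibbs law of the `e^c`-scaled activity, which is the
law the dynamic theorem is run at), the integrated-exponential-cap failure bound by Tonelli + Markov from the first exponential velocity moment
in mean. [cite: Yau1991, §2] -/
theorem stub_reductionTL : DynamicTheoremTL → MesoscaleSuperlinearityE → UniformPressureAlongSolution → GeneralFamilyStaticLLN →
    TrueLawMomentumClosure → TrueLawEnergyClosure → TrueLawCapsPE → OneMeanLowerBound := by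
  intro hdyn hSt2 hSt3 hS5a hS2 hS3 hS4
  -- (A) universal thresholds: the cap level `ηP` and the crux threshold `η₀`
  obtain ⟨ηE, hηE, F, hFa, hEqF, -, -, -⟩ := hsEosLowDensity_proof
  obtain ⟨ηS, hηS, HSt2⟩ := hSt2
  obtain ⟨η3p, hη3p, HSt3⟩ := hSt3
  obtain ⟨ηK2, hηK2, HS2⟩ := hS2
  obtain ⟨ηK3, hηK3, HS3⟩ := hS3
  obtain ⟨ηL, hηL, HL⟩ := stub_ldaGeneralFamilies
  set ηP : ℝ := min (min ηK2 ηK3) (ηE / 2) with hηPdef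
  have hηP : 0 < ηP := lt_min (lt_min hηK2 hηK3) (by positivity)
  obtain ⟨hηPK2, hηPK3, hηPE2⟩ : ηP ≤ ηK2 ∧ ηP ≤ ηK3 ∧ ηP ≤ ηE / 2 :=
    ⟨(min_le_left _ _).trans (min_le_left _ _), (min_le_left _ _).trans (min_le_right _ _), min_le_right _ _⟩
  set η₀ : ℝ := min (ηP / 2) (min (min ηS η3p) ηL) with hη₀def
  have hη₀ : 0 < η₀ := lt_min (by positivity) (lt_min (lt_min hηS hη3p) hηL)
  obtain ⟨hη₀P2, hη₀S, hη₀3, hη₀L⟩ : η₀ ≤ ηP / 2 ∧ η₀ ≤ ηS ∧ η₀ ≤ η3p ∧ η₀ ≤ ηL :=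
    ⟨min_le_left _ _, (min_le_right _ _).trans ((min_le_left _ _).trans (min_le_left _ _)),
      (min_le_right _ _).trans ((min_le_left _ _).trans (min_le_right _ _)), (min_le_right _ _).trans (min_le_right _ _)⟩
  have hηPE : ηP < ηE := by linarith
  have hη₀E : η₀ ≤ ηE := by linarith
  have hη₀K2 : η₀ ≤ ηK2 / 2 := hη₀P2.trans (by linarith)
  have hη₀K3 : η₀ ≤ ηK3 / 2 := hη₀P2.trans (by linarith)
  -- (B) given `M`: `δ₀ := 1`, `τ₀ := 1` (near-constancy is idle; the temperature / drift / `C¹` guards only feed `solution_box`)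
  refine ⟨η₀, hη₀, fun M hM => ⟨1, one_pos, 1, one_pos, fun a₀ θ₀ u₀ ha hθ hu ha0 hθ0 => ?_⟩⟩
  -- (C) given the profile: S5a, S4‴, S2ᵀ, S3ᵀ at the profile, `σ₀`
  obtain ⟨σ5, hσ5, H5⟩ := hS5a a₀ θ₀ u₀ ha hθ hu ha0 hθ0
  obtain ⟨σ4, hσ4, H4⟩ := hS4 ηP hηP a₀ θ₀ u₀ ha hθ hu ha0 hθ0
  obtain ⟨σ2, hσ2, H2⟩ := HS2 a₀ θ₀ u₀ ha hθ hu ha0 hθ0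
  obtain ⟨σ3, hσ3, H3⟩ := HS3 a₀ θ₀ u₀ ha hθ hu ha0 hθ0
  set σ₀ : ℝ := min (min σ5 σ4) (min σ2 σ3) with hσ₀def
  refine ⟨σ₀, lt_min (lt_min hσ5 hσ4) (lt_min hσ2 hσ3), ?_⟩
  intro σ hσ hσlt ε n hε hε0 hn T ρ θ u hE _ Φ
  dsimp only
  intro hP h0 t ht hg
  -- (D) at fixed data: thresholds in `σ`, times, inversion and identification
  have hσ5' : σ < σ5 := hσlt.trans_le ((min_le_left _ _).trans (min_le_left _ _))
  have hσ4' : σ < σ4 := hσlt.trans_le ((min_le_left _ _).trans (min_le_right _ _))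
  have hσ2' : σ < σ2 := hσlt.trans_le ((min_le_right _ _).trans (min_le_left _ _))
  have hσ3' : σ < σ3 := hσlt.trans_le ((min_le_right _ _).trans (min_le_right _ _))
  have hn_top : Tendsto n atTop atTop := tendsto_atTop_of_tendsto_mul_pow_three hσ hε hε0 hn
  obtain ⟨htT, ht1⟩ : t < T ∧ t < 1 := ⟨ht.2.trans_le (min_le_left _ _), ht.2.trans_le (min_le_right _ _)⟩
  have htI : t ∈ Ico 0 T := ⟨ht.1, htT⟩
  have h0I : (0 : ℝ) ∈ Ico 0 T := ⟨le_rfl, ht.1.trans_lt htT⟩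
  have h0t : (0 : ℝ) ∈ Icc 0 t := ⟨le_rfl, ht.1⟩
  -- S5a at `σ`: activity inversion; identification of the Euler data at `t = 0` (two LLNs under the same laws)
  obtain ⟨ρa, hρac, hρa0, hρa1, ⟨c, hc⟩, HLLN⟩ := H5 σ hσ hσ5'
  have ha₀eq : a₀ = fun x => Real.exp c * (ρa x * Real.exp (gChem σ (ρa x))) := by
    funext x; rw [hc x, gChem]; ring
  subst ha₀eq
  obtain ⟨hρ0, hu0, hθ0'⟩ := profiles_eq_of_tendsto
    (P := fun N => particleLaw (Φ N) (canonicalDensity (Torus.geometry (Fin 3)) (ε N) (n N)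
      (localGibbsProfile (fun x => Real.exp c * (ρa x * Real.exp (gChem σ (ρa x)))) u₀ θ₀)))
    hP (fun N z χ => empiricalDensityField ((Φ N).flow 0 z) χ) (fun N z χ => empiricalMomentumField ((Φ N).flow 0 z) χ)
    (fun N z χ => empiricalEnergyField ((Φ N).flow 0 z) χ) hρac hθ hu (hE.smooth_density.isSmooth_slice h0I).continuous
    (hE.smooth_temperature.isSmooth_slice h0I).continuous (hE.smooth_velocity.isSmooth_slice h0I).continuous hρa0
    (fun χ hχ δ' hδ' => HLLN ε n hε hε0 hn Φ hP χ hχ δ' hδ') (fun χ hχ δ' hδ' => h0 χ hχ δ' hδ')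
  subst hρ0 hu0 hθ0'
  -- the constant `e^c` drops out of the canonical law
  have hPeq : ∀ N, particleLaw (Φ N) (canonicalDensity (Torus.geometry (Fin 3)) (ε N) (n N)
      (localGibbsProfile (fun x => Real.exp c * (ρ 0 x * Real.exp (gChem σ (ρ 0 x)))) (u 0) (θ 0))) =
      particleLaw (Φ N) (canonicalDensity (Torus.geometry (Fin 3)) (ε N) (n N)
        (localGibbsProfile (fun x => ρ 0 x * Real.exp (gChem σ (ρ 0 x))) (u 0) (θ 0))) := by
    intro N
    rw [MacroClosureLine.StubLedger.localGibbsProfile_const_mul]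
    congr 1
    funext z
    exact KineticWindowGronwallNegative.canonicalDensity_const_mul (Real.exp_pos c).ne' _ _ z
  -- (E) the hypotheses of the dynamic theorem: bands, statics at `0` (LDA), St3, bookkeeping, box, St2′, caps, true-law closure inputs
  have hbandE : ∀ s ∈ Icc 0 t, ∀ x, ρ s x * σ ^ 3 < ηE := fun s hs x => (hg s hs x).1.trans_le hη₀E
  have hmass : ∫ x, ρ 0 x = 1 := hρa1
  obtain ⟨xm, -, hxm⟩ := isCompact_univ.exists_isMinOn univ_nonempty hρac.continuousOn
  obtain ⟨hπ₀', hm₀i', hm₀'⟩ := HL σ hσ (ρ 0 xm) (hρa0 xm) (ρ 0) hρac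
    (fun x => ⟨hxm (mem_univ x), ((hg 0 h0t x).1.le).trans hη₀L⟩) hmass (u 0) (θ 0) hu hθ hθ0 ε n hε hε0 hn
  have hπ₀ : Tendsto (fun N => (n N : ℝ)⁻¹ * Real.log (canonicalPartition (Torus.geometry (Fin 3)) (ε N) (n N)
      (localGibbsProfile (fun x => ρ 0 x * Real.exp (gChem σ (ρ 0 x))) (u 0) (θ 0)))) atTop
      (nhds (∫ x, ρ 0 x * (ρ 0 x * σ ^ 3 * deriv hsExcessFreeEnergy (ρ 0 x * σ ^ 3)))) := by simpa only [gChem] using hπ₀'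
  have hm₀i : ∀ᶠ N : ℕ in atTop, Integrable (fun z => logProfileObs σ ρ θ u 0 z)
      (particleLaw (Φ N) (canonicalDensity (Torus.geometry (Fin 3)) (ε N) (n N)
        (localGibbsProfile (fun x => Real.exp c * (ρ 0 x * Real.exp (gChem σ (ρ 0 x)))) (u 0) (θ 0)))) := by
    simp only [hPeq]; simpa only [logProfileObs_eq_integral, gChem, particleLaw_eq] using hm₀i'
  have hm₀ : Tendsto (fun N => ∫ z, logProfileObs σ ρ θ u 0 z
      ∂(particleLaw (Φ N) (canonicalDensity (Torus.geometry (Fin 3)) (ε N) (n N)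
        (localGibbsProfile (fun x => Real.exp c * (ρ 0 x * Real.exp (gChem σ (ρ 0 x)))) (u 0) (θ 0))))) atTop
      (nhds (∫ x, ρ 0 x * (Real.log (ρ 0 x) + gChem σ (ρ 0 x) - 3 / 2 * Real.log (2 * Real.pi * θ 0 x) - 3 / 2))) := by
    simp only [hPeq]; simpa only [logProfileObs_eq_integral, gChem, particleLaw_eq] using hm₀'
  have hπ : TendstoUniformlyOn (fun N r => (n N : ℝ)⁻¹ * Real.log (canonicalPartition (Torus.geometry (Fin 3)) (ε N) (n N)
      (localGibbsProfile (fun x => ρ r x * Real.exp (gChem σ (ρ r x))) (u r) (θ r))))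
      (fun r => ∫ x, ρ r x * (ρ r x * σ ^ 3 * deriv hsExcessFreeEnergy (ρ r x * σ ^ 3))) atTop (Icc 0 t) := by
    simpa only [gChem] using HSt3 σ hσ ε n hε hε0 hn T ρ θ u hE hmass t htI (fun s hs x => (hg s hs x).1.trans_le hη₀3)
  have hiso := xr_bookkeeping hηE hFa hEqF hσ hE htI hbandE
  obtain ⟨Mb, hMb, hbox⟩ := solution_box hE htI hM
    (fun s hs x => ⟨(hg s hs x).2.1, (hg s hs x).2.2.1, (hg s hs x).2.2.2.1, (hg s hs x).2.2.2.2⟩)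
  obtain ⟨γ, hγ, Hκ⟩ := HSt2 Mb hMb σ hσ ε n hε hε0 hn
  have HSt2' : ∀ κ : ℝ, 0 < κ → ∀ᶠ N : ℕ in atTop, ∀ r ∈ Icc 0 t,
      ∫⁻ w, ENNReal.ofReal (Real.exp (γ * (n N : ℝ) * fluctuationE (mesoRadius (n N)) (ρ r) (θ r) (u r) w))
        ∂(particleLaw (Φ N) (canonicalDensity (Torus.geometry (Fin 3)) (ε N) (n N)
          (localGibbsProfile (fun x => ρ r x * Real.exp (gChem σ (ρ r x))) (u r) (θ r)))) ≤ ENNReal.ofReal (Real.exp (κ * (n N : ℝ))) := by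
    intro κ hκ
    filter_upwards [Hκ κ hκ] with N hN r hr
    have hrT : r ∈ Ico 0 T := ⟨hr.1, hr.2.trans_lt htT⟩
    have key := hN (ρ r) (θ r) (u r) (hE.smooth_density.isSmooth_slice hrT).continuous
      (hE.smooth_temperature.isSmooth_slice hrT).continuous (hE.smooth_velocity.isSmooth_slice hrT).continuous
      ((DenseExcursionEverywhere.integral_density_eq hE hrT).trans hmass) (fun x => ⟨((hbox r hr).1 x).1,
        ((hg r hr x).1.le).trans hη₀S, ((hbox r hr).1 x).2.1, ((hbox r hr).1 x).2.2.1, ((hbox r hr).1 x).2.2.2⟩) (hbox r hr).2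
    simpa only [particleLaw_eq, gChem] using key
  obtain ⟨hcapP, hexpAll⟩ := H4 σ hσ hσ4' ε n hε hε0 hn T ρ θ u hE Φ hP h0 t htI
    (fun s hs x => ((hg s hs x).1.le).trans hη₀P2)
  -- the INTEGRATED exponential cap along the true law: Tonelli along the flow + Markov from the first exponential moment (c″, `b = 1`)
  obtain ⟨A₁, hA₁⟩ := hexpAll 1 one_pos
  simp only [one_mul] at hA₁
  have hcapX : ∀ K' : ℝ, 0 < K' → ∀ᶠ N : ℕ in atTop,
      particleLaw (Φ N) (canonicalDensity (Torus.geometry (Fin 3)) (ε N) (n N)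
        (localGibbsProfile (fun x => Real.exp c * (ρ 0 x * Real.exp (gChem σ (ρ 0 x)))) (u 0) (θ 0)))
        {z | ENNReal.ofReal K' < ∫⁻ r in Set.Icc 0 t,
          ENNReal.ofReal ((n N : ℝ)⁻¹ * ∑ i : Fin (n N), Real.exp ‖((Φ N).flow r z i).2‖)} ≤
      ENNReal.ofReal (t * max A₁ 0 / K') := by
    intro K' hK'
    filter_upwards [hA₁] with N hN
    haveI := hP N
    exact intExpMoment_markov (Φ N) _ (by rw [particleLaw_eq]; exact withDensity_absolutelyContinuous _ _)
      (le_max_right A₁ 0) ht.1 (fun s hs => (hN s hs).trans (ENNReal.ofReal_le_ofReal (le_max_left _ _))) K' hK'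
  have hC₄ : 0 ≤ t * max A₁ 0 := mul_nonneg ht.1 (le_max_right A₁ 0)
  -- the family of exponential velocity moments in mean (c″), with nonnegative constants
  have hexpm : ∀ b : ℝ, 0 < b → ∃ A : ℝ, 0 ≤ A ∧ ∀ᶠ N : ℕ in atTop, ∀ s ∈ Set.Icc 0 t,
      ∫⁻ z, ENNReal.ofReal ((n N : ℝ)⁻¹ * ∑ i : Fin (n N), Real.exp (b * ‖((Φ N).flow s z i).2‖))
        ∂(particleLaw (Φ N) (canonicalDensity (Torus.geometry (Fin 3)) (ε N) (n N)
          (localGibbsProfile (fun x => Real.exp c * (ρ 0 x * Real.exp (gChem σ (ρ 0 x)))) (u 0) (θ 0)))) ≤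
      ENNReal.ofReal A := by
    intro b hb
    obtain ⟨A, hA⟩ := hexpAll b hb
    exact ⟨max A 0, le_max_right _ _, hA.mono fun N hN s hs => (hN s hs).trans (ENNReal.ofReal_le_ofReal (le_max_left _ _))⟩
  -- NEW (v25): the two closure inputs ALONG THE TRUE LAW at the identified data (bands `ρσ³ < η₀ ≤ ηP/2 ≤ ηK/2`)
  have H2' := H2 σ hσ hσ2' ε n hε hε0 hn T ρ θ u hE Φ hP h0 t htI (fun s hs x => ((hg s hs x).1.le).trans hη₀K2)
  have H3' := H3 σ hσ hσ3' ε n hε hε0 hn T ρ θ u hE Φ hP h0 t htI (fun s hs x => ((hg s hs x).1.le).trans hη₀K3)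
  -- the dynamic theorem at these data (cap level `K` moved to the front of the closure hypotheses)
  have key := hdyn hηE hFa hEqF hσ hE htI ht1 hbandE hmass hηP hηPE hn_top hε Φ
    (fun N => particleLaw (Φ N) (canonicalDensity (Torus.geometry (Fin 3)) (ε N) (n N)
      (localGibbsProfile (fun x => Real.exp c * (ρ 0 x * Real.exp (gChem σ (ρ 0 x)))) (u 0) (θ 0))))
    hPeq hP hπ₀ hπ hm₀ hm₀i hiso hγ HSt2' hcapP hC₄ hcapX hexpm hηPK2 hηPK3
    (fun K' hK' s τ hs hτ hst ψ hψ hψb δ' hδ' => H2' s τ hs hτ hst ψ hψ hψb δ' hδ' K' hK')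
    (fun K' hK' s τ hs hτ hst φ hφ hφb δ' hδ' => H3' s τ hs hτ hst φ hφ hφb δ' hδ' K' hK')
  -- `logProfileObs_eq_integral` identifies the conclusion with the `let Λ` of `OneMeanLowerBound`
  exact fun κ hκ => (key κ hκ).mono fun N hN => by simpa only [logProfileObs_eq_integral, gChem] using hN

end Summit.AtomisticToContinuum.HydrodynamicLimit.Theorems.NearConstantShortTimeHL

end
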